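import Summits.CriticalPhenomena.PercolationContinuityZ3.Theorems.Transplant.QuarterSlabSupercritical
import HarnessLib

/-!
# The DST transfer for an ARBITRARY COARSE REGION: a supercritical slab percolates inside any fine region holding the boxes of a coarse
# region in which high-density `5`-dependent bond percolation survives

builds on p205010 (kernel theorem, internal audit signed; external expert review pending) — NOT used in this file.
Lane `prim-bschramm`, seat `prim-bschramm-p2` (gen 24; class C1b, METHOD = input substitution; memo `HOME/bschramm/P2-LATTICES.md` §86);
helper file (`--supports stmt-CriticalPhenomena-4575 --as helper`).

THE POINT.  Gen 21–23 ran Duminil-Copin–Sidoravicius–Tassion's renormalisation AT A SUPERCRITICAL `p` four times, once per coarse region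
(quadrant `QuarterSlabSupercritical`, slope-`½` cone `ConeSlabSupercritical`, slope-`¼` cone `ThinConeSlabSupercritical`, slope-`1/m` cone
`SectorSlabSupercritical`), each time re-typing §2.2's gluing with the region written out.  This file types the device ONCE for an arbitrary
coarse region `C ⊆ ℤ²` and arbitrary fine regions `T n ⊆ ℤ²` tied by the only property the gluing uses —
  (BOX)  for every coarse vertex `x ∈ C` and direction `i`, the box `4n·x + 2n·eᵢ + B_{6n}` of the coarse edge `{x, x + eᵢ}` lies in `T n` —
and the only probabilistic input — (DEP) for some `η > 0`, every `5`-dependent bond percolation on `ℤ²` with edge densities `≥ 1 - η` percolates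
INSIDE `C` from `0` with positive probability (e.g. `DepQuadrant.dependentPercolation_quadrant'`, `DepLatticeMap.dependentPercolation_latticeMap`):
* §1 `slabConn_of_coarse_reachable_in`, `exists_percolatesVia_of_coarse` (lattice configurations: an infinite good cluster of `0` in the coarse
  step graph of `C` forces an infinite open path of the slab inside `T n × {0,…,k}` from a vertex of `\overline{B_u}`);
* §2 **`exists_percolatesVia_pos_of_theta_slab_pos`**: under (BOX), (DEP): `0 < k → 0 < θ_{S_k}(0,p) →
  ∃ n ≥ 1, ∃ a ∈ \overline{B_n}, 0 < P_p(a ↔ ∞ inside T n × {0,…,k})`.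
USE (memo §86): the TILTED sector-slabs (planar sectors strictly inside an open quadrant × `{0..k}`), whose coarse region is the image of a shear
composed with the folded staircase (`Transplant/TiltedStairDesign.lean`); every earlier region is an instance.
[cite: DuminilCopinSidoraviciusTassion2016, §2.1 eq. (13), §2.2 (p. 6)] [cite: GrimmettPercolation1999, §7.2 Thm. (7.2) p. 148]
-/

noncomputable section

namespace Summit.CriticalPhenomena.PercolationContinuityZ3.Theorems.Transplant

namespace CoarseTransfer

open MeasureTheory Literature.Probability.Percolation Literature.Probability.LatticeModels SimpleGraph
open scoped ENNReal

variable (k : ℕ)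

/-! ## §1 From an infinite good cluster in the coarse region to an infinite open path inside `T × {0,…,k}` -/

/-- An edge of the step graph of `C` has both endpoints in `C`. [folklore] -/
theorem mem_of_mem_edgeSet {C : Set (Site 2)} {b c : Site 2} (h : s(b, c) ∈ (withinGraph (zdGraph 2) C).edgeSet) :
    b ∈ C ∧ c ∈ C := by
  rw [SimpleGraph.mem_edgeSet, withinGraph_adj] at h
  exact ⟨h.2.1, h.2.2⟩

/-- (BOX) gives the uniqueness box: `4n·x + B_{3n} ⊆ T` for `x ∈ C`. [cite: DuminilCopinSidoraviciusTassion2016, §2.2] -/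
theorem sqBox_three_subset_of_box {C : Set (Site 2)} {T : Set (ℤ × ℤ)} {n : ℕ}
    (hT : ∀ x ∈ C, ∀ i : Fin 2, sqBox (coarsePt n x + coarseShift (2 * n) i) (6 * n) ⊆ T) {x : Site 2} (hx : x ∈ C) :
    sqBox (coarsePt n x) (3 * n) ⊆ T :=
  (sqBox_subset_region_left n (coarsePt n x) 0).trans (hT x hx 0)

/-- **Chaining good edges inside the region** (DST 2016, §2.2 with the region bookkeeping, generic region): if the coarse vertex `y ≠ 0` is
joined to `0` by good edges OF THE COARSE REGION `C`, and (BOX) holds for `C, T`, then `\overline{B_u}` is joined to `\overline{4n·y + B_u}` by an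
open path of the slab all of whose vertices lie in `\overline{T}` (lattice configurations; the mechanism is `slabConn_of_glue`).
[cite: DuminilCopinSidoraviciusTassion2016, §2.2] -/
theorem slabConn_of_coarse_reachable_in {C : Set (Site 2)} {T : Set (ℤ × ℤ)} {n u : ℕ}
    (hT : ∀ x ∈ C, ∀ i : Fin 2, sqBox (coarsePt n x + coarseShift (2 * n) i) (6 * n) ⊆ T)
    {ω : BondConfig (slab 3 k)} (hω : ω ⊆ (slabGraph 3 k).edgeSet) (hu : u ≤ n) {y : Site 2}
    (hy : (openGraph (coarseConfig k n u ω ∩ (withinGraph (zdGraph 2) C).edgeSet)).Reachable 0 y) (hy0 : y ≠ 0) :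
    ω ∈ slabConn k T (sqBox 0 u) (sqBox (coarsePt n y) u) := by
  rw [SimpleGraph.reachable_iff_reflTransGen] at hy
  suffices h : y = 0 ∨ ω ∈ slabConn k T (sqBox 0 u) (sqBox (coarsePt n y) u) by tauto
  clear hy0
  induction hy with
  | refl => exact Or.inl rfl
  | @tail b c _ hbc ih =>
    right
    obtain ⟨⟨hmem, hC⟩, -⟩ := (openGraph_adj _ b c).1 hbc
    obtain ⟨hbC, hcC⟩ := mem_of_mem_edgeSet hC
    obtain ⟨x, i, he, hcross, huz, huz'⟩ := hmem
    have hmono : ∀ {B X Y : Set (ℤ × ℤ)}, B ⊆ T → ω ∈ slabConn k B X Y → ω ∈ slabConn k T X Y :=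
      fun hB h => openCrossing_mono (slabLift_mono k hB) subset_rfl subset_rfl h
    rw [Sym2.eq_iff] at he
    by_cases hb00 : b = 0
    · -- the first edge of the chain
      subst hb00
      rcases he with ⟨hx, hc⟩ | ⟨hx, hc⟩
      · subst hc
        subst hx
        rw [coarsePt_add_single]
        simpa using hmono (hT _ hbC i) hcross
      · subst hc
        have h0 : coarsePt n c + coarseShift (4 * n) i = 0 := by
          rw [← coarsePt_add_single, ← hx, coarsePt_zero]
        rw [h0] at hcross
        rw [slabConn_comm]
        exact hmono (hT _ hcC i) hcross
    · -- gluing through the block at `b`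
      have hb : ω ∈ slabConn k T (sqBox 0 u) (sqBox (coarsePt n b) u) := by tauto
      rcases he with ⟨hx, hc⟩ | ⟨hx, hc⟩
      · -- `b = x`, `c = x + eᵢ`
        subst hc
        subst hx
        rw [coarsePt_add_single]
        refine slabConn_of_glue k hω (T := T) (B₁ := T) (B₂ := sqBox (coarsePt n b + coarseShift (2 * n) i) (6 * n))
          (S' := sqBox (coarsePt n b) u) (c := coarsePt n b) (m := 3 * n) subset_rfl (hT _ hbC i)
          (sqBox_three_subset_of_box hT hbC) (sqBox_mono _ (by omega)) (sqBox_zero_inter_subset_sqSphere hu hb00)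
          (sqBox_shift_inter_subset_sqSphere hu (coarsePt n b) i).1 hb ?_ huz
        rw [slabConn_comm]
        exact hcross
      · -- `b = x + eᵢ`, `c = x`
        subst hc
        have hcb : coarsePt n b = coarsePt n c + coarseShift (4 * n) i := by
          rw [hx, coarsePt_add_single]
        rw [hcb] at hb
        have hfar : sqBox 0 u ∩ sqBox (coarsePt n c + coarseShift (4 * n) i) (3 * n) ⊆
            sqSphere (coarsePt n c + coarseShift (4 * n) i) (3 * n) := by
          rw [← hcb]; exact sqBox_zero_inter_subset_sqSphere hu hb00
        have h3 : sqBox (coarsePt n c + coarseShift (4 * n) i) (3 * n) ⊆ T := by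
          rw [← hcb]; exact sqBox_three_subset_of_box hT hbC
        exact slabConn_of_glue k hω (T := T) (B₁ := T) (B₂ := sqBox (coarsePt n c + coarseShift (2 * n) i) (6 * n))
          (S' := sqBox (coarsePt n c + coarseShift (4 * n) i) u) (c := coarsePt n c + coarseShift (4 * n) i) (m := 3 * n)
          subset_rfl (hT _ hcC i) h3 (sqBox_mono _ (by omega)) hfar (sqBox_shift_inter_subset_sqSphere hu (coarsePt n c) i).2 hb hcross huz'

/-- **An infinite good cluster of the origin IN THE COARSE REGION forces an infinite open cluster INSIDE `\overline{T}` at a vertex of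
`\overline{B_u}`** (DST 2016, §2.2, generic region; lattice configurations `ω`). [cite: DuminilCopinSidoraviciusTassion2016, §2.2] -/
theorem exists_percolatesVia_of_coarse {C : Set (Site 2)} {T : Set (ℤ × ℤ)} {n u : ℕ}
    (hT : ∀ x ∈ C, ∀ i : Fin 2, sqBox (coarsePt n x + coarseShift (2 * n) i) (6 * n) ⊆ T)
    {ω : BondConfig (slab 3 k)} (hω : ω ⊆ (slabGraph 3 k).edgeSet) (hn : 1 ≤ n) (hu : u ≤ n)
    (hinf : (openCluster (coarseConfig k n u ω ∩ (withinGraph (zdGraph 2) C).edgeSet) (0 : Site 2)).Infinite) :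
    ∃ a ∈ slabLift k (sqBox 0 u), ω ∈ percolatesVia (withinGraph (slabGraph 3 k) (slabLift k T)) a := by
  by_contra hcon
  push Not at hcon
  set KT := withinGraph (slabGraph 3 k) (slabLift k T) with hKT
  have hX0fin : (slabLift k (sqBox 0 u)).Finite := slabLift_finite k (sqBox_finite 0 u)
  have hU : (⋃ a ∈ slabLift k (sqBox 0 u), openClusterIn KT ω a).Finite :=
    hX0fin.biUnion fun a ha => Set.not_infinite.1 (hcon a ha)
  -- a bound on the planar coordinates of the finitely many constrained clusters
  obtain ⟨M, hM⟩ : ∃ M : ℕ, ∀ v ∈ ⋃ a ∈ slabLift k (sqBox 0 u), openClusterIn KT ω a,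
      |(planar k v).1| ≤ M ∧ |(planar k v).2| ≤ M := by
    have himg := hU.image fun v => max |(planar k v).1| |(planar k v).2|
    obtain ⟨B, hB⟩ := himg.bddAbove
    refine ⟨B.toNat, fun v hv => ?_⟩
    have h := hB (Set.mem_image_of_mem _ hv)
    have h' : max |(planar k v).1| |(planar k v).2| ≤ (B.toNat : ℤ) := h.trans (Int.self_le_toNat B)
    exact ⟨(le_max_left _ _).trans h', (le_max_right _ _).trans h'⟩
  -- a far coarse vertex in the good cluster of `0` inside `C`
  obtain ⟨y, hy, hyF⟩ := hinf.exists_notMem_finset (box 2 (M + u))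
  have hy0 : y ≠ 0 := by
    rintro rfl
    apply hyF
    rw [mem_box]
    intro i
    simp only [Pi.zero_apply]
    push_cast
    omega
  obtain ⟨a, ha, b, hb, hab⟩ := slabConn_of_coarse_reachable_in k hT hω hu hy hy0
  have hbU : b ∈ ⋃ a ∈ slabLift k (sqBox 0 u), openClusterIn KT ω a :=
    Set.mem_biUnion ha (QuarterSlab.mem_openClusterIn_of_openConnIn k hω hab)
  obtain ⟨hb1, hb2⟩ := hM b hbU
  -- but `planar b ∈ 4n·y + B_u` is far
  have hyfar : (M : ℤ) + u + 1 ≤ |y 0| ∨ (M : ℤ) + u + 1 ≤ |y 1| := by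
    simp only [mem_box, not_forall] at hyF
    obtain ⟨j, hj⟩ := hyF
    fin_cases j
    · left; rw [le_abs]; simp at hj; omega
    · right; rw [le_abs]; simp at hj; omega
  have hcp := abs_le_abs_coarsePt hn y
  simp only [mem_slabLift_iff, sqBox, Set.mem_setOf_eq] at hb
  rw [abs_le] at hb1 hb2
  obtain ⟨hb3, hb4⟩ := hb
  rw [abs_le] at hb3 hb4
  rcases hyfar with h | h
  · have h1 : (M : ℤ) + u + 1 ≤ |(coarsePt n y).1| := h.trans hcp.1
    rw [le_abs] at h1
    omega
  · have h1 : (M : ℤ) + u + 1 ≤ |(coarsePt n y).2| := h.trans hcp.2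
    rw [le_abs] at h1
    omega

/-! ## §2 The measure-level transfer: `θ_{S_k}(p) > 0` gives percolation inside `\overline{T n}` with positive probability -/

/-- **Supercritical slabs percolate inside every fine region holding the boxes of a coarse region with dependent percolation** (`k > 0`):
if (DEP) every `5`-dependent bond percolation on `ℤ²` of edge density `≥ 1 - η` percolates inside `C` from `0` with positive probability,
(BOX) ties `C` to the fine regions `T n`, and `θ_{S_k}(0, p) > 0`, then for some block size `n ≥ 1` and some vertex `a` of
`\overline{B_n}`, `P_p(a ↔ ∞ inside \overline{T n}) > 0`.  DST's finite-size criterion at `p` (`DuminilCopinSidoraviciusTassion2016_goodEvent_likely_holds`),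
the good-edge law as a `5`-dependent bond percolation on `ℤ²` (`disjoint_coarseRegion`, `real_goodEvent_shift`), (DEP) and §1.
[cite: DuminilCopinSidoraviciusTassion2016, §2.1 eq. (13) and §2.2 (p. 6)] -/
theorem exists_percolatesVia_pos_of_theta_slab_pos {C : Set (Site 2)} {T : ℕ → Set (ℤ × ℤ)}
    (hT : ∀ n : ℕ, ∀ x ∈ C, ∀ i : Fin 2, sqBox (coarsePt n x + coarseShift (2 * n) i) (6 * n) ⊆ T n)
    (hdep : ∃ η : ℝ, 0 < η ∧ ∀ (μ : Measure (BondConfig (Site 2))) [IsProbabilityMeasure μ],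
      (∀ (F₁ F₂ : Finset (Sym2 (Site 2))),
          (∀ e₁ ∈ F₁, ∀ e₂ ∈ F₂, ∀ a ∈ e₁, ∀ b ∈ e₂, ((5 : ℕ) : ℤ) ≤ max |a 0 - b 0| |a 1 - b 1|) →
          ∀ (A B : Set (BondConfig (Site 2))), DeterminedBy A (↑F₁ : Set (Sym2 (Site 2))) →
            DeterminedBy B (↑F₂ : Set (Sym2 (Site 2))) → MeasurableSet A → MeasurableSet B →
            μ (A ∩ B) = μ A * μ B) →
      (∀ e ∈ (zdGraph 2).edgeSet, 1 - η ≤ μ.real {ω | e ∈ ω}) →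
      0 < μ.real (percolatesVia (withinGraph (zdGraph 2) C) 0))
    (hk : 0 < k) (p : unitInterval) (hθ : 0 < theta (slabGraph 3 k) (slabOrigin 3 k) p) :
    ∃ n : ℕ, 1 ≤ n ∧ ∃ a ∈ slabLift k (sqBox 0 n),
      0 < (bondPercolation (slabGraph 3 k) p).real (percolatesVia (withinGraph (slabGraph 3 k) (slabLift k (T n))) a) := by
  obtain ⟨η₀, hη₀pos, hD5⟩ := hdep
  obtain ⟨n, u, hn, hu, hgood⟩ := DuminilCopinSidoraviciusTassion2016_goodEvent_likely_holds k hk p hθ η₀ hη₀pos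
  set P := bondPercolation (slabGraph 3 k) p with hP
  set Kq := withinGraph (zdGraph 2) C with hKq
  -- the good-edge configuration as a dependent bond percolation on `ℤ²`
  set μ := P.map (coarseConfig k n u) with hμ
  haveI : IsProbabilityMeasure μ :=
    Measure.isProbabilityMeasure_map (measurable_coarseConfig k n u).aemeasurable
  have hdep : ∀ (F₁ F₂ : Finset (Sym2 (Site 2))),
      (∀ e₁ ∈ F₁, ∀ e₂ ∈ F₂, ∀ a ∈ e₁, ∀ b ∈ e₂, ((5 : ℕ) : ℤ) ≤ max |a 0 - b 0| |a 1 - b 1|) →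
      ∀ (A B : Set (BondConfig (Site 2))), DeterminedBy A (↑F₁ : Set (Sym2 (Site 2))) →
        DeterminedBy B (↑F₂ : Set (Sym2 (Site 2))) → MeasurableSet A → MeasurableSet B →
        μ (A ∩ B) = μ A * μ B := by
    intro F₁ F₂ hfar A B hA hB hAm hBm
    rw [hμ, Measure.map_apply (measurable_coarseConfig k n u) (hAm.inter hBm),
      Measure.map_apply (measurable_coarseConfig k n u) hAm,
      Measure.map_apply (measurable_coarseConfig k n u) hBm, Set.preimage_inter]
    exact bondPercolation_inter_of_disjoint (slabGraph 3 k) p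
      (disjoint_coarseRegion k hn (by exact_mod_cast hfar))
      (determinedBy_preimage_coarseConfig k n u hA) (determinedBy_preimage_coarseConfig k n u hB)
      (hAm.preimage (measurable_coarseConfig k n u)) (hBm.preimage (measurable_coarseConfig k n u))
  have hmarg : ∀ e ∈ (zdGraph 2).edgeSet, 1 - η₀ ≤ μ.real {ω | e ∈ ω} := by
    intro e he
    have key : ∀ (x : Site 2) (i : Fin 2),
        1 - η₀ ≤ μ.real {ω : BondConfig (Site 2) | s(x, x + Pi.single i 1) ∈ ω} := by
      intro x i
      rw [hμ, map_measureReal_apply (measurable_coarseConfig k n u) (measurableSet_mem _)]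
      have hpre : coarseConfig k n u ⁻¹' {ω : BondConfig (Site 2) | s(x, x + Pi.single i 1) ∈ ω} =
          goodEvent k n u (coarsePt n x) i := by
        ext ω; exact mk_mem_coarseConfig_iff k n u ω x i
      rw [hpre, hP, real_goodEvent_shift]
      have h1 := hgood i
      linarith
    induction e using Sym2.ind with
    | h a b =>
      rw [SimpleGraph.mem_edgeSet] at he
      obtain ⟨i, hab | hab⟩ := (zdGraph_adj_iff a b).1 he
      · rw [hab]; exact key a i
      · rw [hab, Sym2.eq_swap]; exact key b i
  -- percolation of the good edges inside the coarse region, transferred to the slab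
  have hperc := hD5 μ hdep hmarg
  rw [hμ, map_measureReal_apply (measurable_coarseConfig k n u) (measurableSet_percolatesVia Kq 0)] at hperc
  have hle : P.real (coarseConfig k n u ⁻¹' percolatesVia Kq 0) ≤
      P.real (⋃ a ∈ slabLift k (sqBox 0 u), percolatesVia (withinGraph (slabGraph 3 k) (slabLift k (T n))) a) := by
    refine ENNReal.toReal_mono (measure_ne_top _ _) (measure_mono_ae ?_)
    filter_upwards [ProbabilityTheory.setBernoulli_ae_subset (u := (slabGraph 3 k).edgeSet) (p := p)] with ω hω hmem
    obtain ⟨a, ha, hinf⟩ := exists_percolatesVia_of_coarse k (hT n) hω hn hu hmem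
    exact Set.mem_biUnion ha hinf
  obtain ⟨a, ha, hθa⟩ : ∃ a ∈ slabLift k (sqBox 0 u),
      0 < P.real (percolatesVia (withinGraph (slabGraph 3 k) (slabLift k (T n))) a) := by
    by_contra hcon
    push Not at hcon
    have hnull : P (⋃ a ∈ slabLift k (sqBox 0 u), percolatesVia (withinGraph (slabGraph 3 k) (slabLift k (T n))) a) = 0 := by
      refine (measure_biUnion_null_iff (slabLift_finite k (sqBox_finite 0 u)).countable).2 fun a ha => ?_
      have := hcon a ha
      have h0 : P.real (percolatesVia (withinGraph (slabGraph 3 k) (slabLift k (T n))) a) = 0 :=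
        le_antisymm this measureReal_nonneg
      exact (measureReal_eq_zero_iff (measure_ne_top _ _)).1 h0
    have : P.real (⋃ a ∈ slabLift k (sqBox 0 u), percolatesVia (withinGraph (slabGraph 3 k) (slabLift k (T n))) a) = 0 := by
      rw [measureReal_def, hnull]; simp
    linarith
  exact ⟨n, hn, a, slabLift_mono k (sqBox_mono 0 hu) ha, hθa⟩

end CoarseTransfer

end Summit.CriticalPhenomena.PercolationContinuityZ3.Theorems.Transplant

end
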